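import Literature.AlgebraicGeometry.Motives.ChowConeComponents
import Mathlib.LinearAlgebra.Complex.FiniteDimensional
import HarnessLib

/-!
# Analytic sets with proper projection are analytic covers (Chirka §3.7, §4.1, §4.4)

Family `hodge` (Track 2 foundations: Bishop's theorem on limits of analytic sets,
[Chirka1989, §15.5]), layer `Literature/Geometry/Kaehler` (model-space several complex variables,
namespace `Literature.Geometry.Kaehler.SCV`).

## Setting ("proper projection")

`E'` is a finite-dimensional complex normed space (the base), the fibre is `ℂᵐ⁺¹`,
`π (z', w) = z'`, `U' ⊆ E'` is open and `Z ⊆ E' × ℂᵐ⁺¹` satisfies, *over `U'`*: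

* (`hcl`) `Z` is closed over `U'`: a point of the closure of `Z` lying over `U'` belongs to `Z`;
* (`han`) `Z` is cut out by holomorphic equations near each of its points over `U'`
  (`Literature.Analysis.Complex.SCV.IsZeroSetAt`);
* (`hR`) the fibre coordinates of the points of `Z` over `U'` are bounded by `R`.

This is the situation of [Chirka1989, §3.7]: an analytic subset of `U' × U''` whose projection to
`U'` is proper. The typical instance (`§ Rim`) is an analytic set near a closed polydisc
`closedBall a' ε ×ˢ closedBall a'' r` which does not meet the rim
`closedBall a' ε ×ˢ sphere a'' r`, intersected with the open polydisc.

## Contents (all proved; the cone case `Literature/AlgebraicGeometry/Motives/ChowCone*.lean` of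
the same architecture is the template, here freed from the conic hypotheses)

* `fibre_finite_of_proper`, `exists_ball_fibre_subset_of_proper` — finite fibres, properness.
* `exists_local_cover_of_proper` — **the local analytic cover over a base point**
  [Chirka1989, §3.7 Thm.]: a ball `V ∋ z'₀` in `U'`, a holomorphic `Δ ≢ 0` on `V` and a bound `K`
  such that all fibres over `V` have at most `K` points and over a neighbourhood of every point of
  `V ∩ {Δ ≠ 0}` the set `Z` is the union of the graphs of finitely many holomorphic maps with
  pairwise distinct values.
* the *unramified part* `G ⊆ U'` of the projection (a parameter characterised by `hG`): it is
  open (`isOpen_good`), its complement is thin (`exists_thin_good_of_proper`), `U' ⊆ closure G`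
  (`subset_closure_good_of_proper`); uniform fibre bound on compacts
  (`exists_forall_fibre_card_le_of_proper`); and **over an open `V' ⊆ U'` with a uniform fibre
  bound the part of `Z` over `G ∩ V'` is a `Literature.Analysis.Complex.SCV.CoverPiece`**
  (`coverPiece_good_of_proper`) [Chirka1989, §4.1].
* `isRegPt_of_mem_good` — points of `Z` over `G` are regular of codimension `m + 1`;
  `mem_closure_good_of_isRegPt_of_proper` — **a regular point of codimension `m + 1` lies in the
  closure of the part over `G`** [Chirka1989, §4.4, proof of the Remmert–Stein theorem]; hence if
  all regular points of `Z` over `U'` have codimension `m + 1` (pure dimension `dim E'`), the part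
  of `Z` over `G` is dense in `Z` (`subset_closure_good_of_pure`).
* `§ Rim`: the reduction of the polydisc-with-empty-rim situation to the setting above
  (`closure_box_of_rim`, `isZeroSetAt_box_of_rim`, `norm_snd_le_of_box`, `pure_box_of_pure`) and
  the packaged statement `exists_coverPiece_of_rim` used in the proof of Bishop's theorem
  [Chirka1989, §15.5, p. 203: "`A_j ∩ U` is an analytic cover over `U'`"].

## References

* [Chirka1989] E. M. Chirka, *Complex Analytic Sets*, Kluwer (1989), §3.1 (5), §3.3 Prop. 1,
  §3.7 Thm., §4.1, §4.4, §15.5.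
-/

noncomputable section

open scoped Topology
open Set Filter Metric Function
open Literature.Analysis.Complex.SCV (IsZeroSetAt CoverSetup CoverPiece exists_coverSetup rootBox
  exists_forall_ne_zero_of_not_eventuallyEq eqOn_zero_of_preconnected_of_eventuallyEq_zero)
open Literature.AlgebraicGeometry.Motives (exists_pos_le_forall exists_pairwiseDisjoint_ball
  mem_closure_regLocus)

namespace Literature.Geometry.Kaehler
namespace SCV

section ProperProjection

variable {E' : Type*} [NormedAddCommGroup E'] [NormedSpace ℂ E'] {m : ℕ}
  {Z : Set (E' × (Fin (m + 1) → ℂ))} {U' : Set E'} {R : ℝ}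

/-! ### Elementary tools -/

/-- Finite products of holomorphic functions are holomorphic. [folklore] -/
private theorem differentiableOn_finset_prod_base {ι : Type*} (s : Finset ι) {g : ι → E' → ℂ}
    {U : Set E'} (h : ∀ i ∈ s, DifferentiableOn ℂ (g i) U) :
    DifferentiableOn ℂ (fun x => ∏ i ∈ s, g i x) U := by
  classical
  induction s using Finset.induction_on with
  | empty => simp only [Finset.prod_empty]; exact differentiableOn_const _
  | insert a s ha ih =>
    simp only [Finset.prod_insert ha]
    exact (h a (Finset.mem_insert_self a s)).mul (ih fun i hi => h i (Finset.mem_insert_of_mem hi))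

/-- **Locality of the sheet description**: if over `ball z' δ` the set `Z` is the union of the
graphs of the `τ j`, the same holds over the smaller ball `ball y (δ - dist y z')`, `y ∈ ball z' δ`,
with the same sheets. [folklore] -/
private theorem sheets_restrict {z' y : E'} {δ : ℝ} (hy : y ∈ ball z' δ) {k : ℕ}
    {τ : Fin k → E' → (Fin (m + 1) → ℂ)} (hτd : ∀ j, DifferentiableOn ℂ (τ j) (ball z' δ))
    (hτne : ∀ y' ∈ ball z' δ, ∀ j j', j ≠ j' → τ j y' ≠ τ j' y')
    (hτZ : ∀ y' ∈ ball z' δ, ∀ w, (y', w) ∈ Z ↔ ∃ j, w = τ j y') :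
    0 < δ - dist y z' ∧ (∀ j, DifferentiableOn ℂ (τ j) (ball y (δ - dist y z'))) ∧
      (∀ y' ∈ ball y (δ - dist y z'), ∀ j j', j ≠ j' → τ j y' ≠ τ j' y') ∧
      ∀ y' ∈ ball y (δ - dist y z'), ∀ w, (y', w) ∈ Z ↔ ∃ j, w = τ j y' := by
  have hsub : ball y (δ - dist y z') ⊆ ball z' δ := ball_subset_ball' (by linarith)
  rw [mem_ball] at hy
  exact ⟨by linarith, fun j => (hτd j).mono hsub, fun y' hy' => hτne y' (hsub hy'),
    fun y' hy' => hτZ y' (hsub hy')⟩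

/-! ### Finite fibres and properness -/

/-- **The fibres over `U'` are finite**: the fibre `{w | (z', w) ∈ Z}`, `z' ∈ U'`, is a compact
subset of `ℂᵐ⁺¹` (closed by `hcl`, bounded by `hR`) which is cut out by holomorphic equations near
each of its points (slices of the equations of `Z`), hence finite.
[cite: Chirka1989, §3.3 Prop. 1, p. 32, and §3.1 (5), p. 29] -/
theorem fibre_finite_of_proper (hcl : ∀ x ∈ closure Z, x.1 ∈ U' → x ∈ Z)
    (han : ∀ x ∈ Z, x.1 ∈ U' → IsZeroSetAt Z x) (hR : ∀ x ∈ Z, x.1 ∈ U' → ‖x.2‖ ≤ R)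
    {z' : E'} (hz' : z' ∈ U') : {w : Fin (m + 1) → ℂ | (z', w) ∈ Z}.Finite := by
  have hc : Continuous fun w : Fin (m + 1) → ℂ => ((z', w) : E' × (Fin (m + 1) → ℂ)) := by
    fun_prop
  have hclosed : IsClosed {w : Fin (m + 1) → ℂ | (z', w) ∈ Z} := by
    rw [← closure_subset_iff_isClosed]
    intro w hw
    have h1 : ((z', w) : E' × (Fin (m + 1) → ℂ)) ∈ closure Z := by
      have := (hc.closure_preimage_subset (t := Z)) hw
      simpa using this
    exact hcl _ h1 hz'
  have hbdd : Bornology.IsBounded {w : Fin (m + 1) → ℂ | (z', w) ∈ Z} := by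
    refine (isBounded_closedBall (x := (0 : Fin (m + 1) → ℂ)) (r := R)).subset ?_
    intro w hw
    rw [mem_closedBall, dist_zero_right]
    exact hR (z', w) hw hz'
  have hcpt : IsCompact {w : Fin (m + 1) → ℂ | (z', w) ∈ Z} :=
    Metric.isCompact_of_isClosed_isBounded hclosed hbdd
  exact finite_of_isCompact_of_isZeroSetAt hcpt fun w hw => (han (z', w) hw hz').slice

omit [NormedAddCommGroup E'] [NormedSpace ℂ E'] in
/-- Points of a finite fibre are isolated in it. [folklore] -/
private theorem eventually_notMem_fibre_of_finite {z' : E'}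
    (hfin : {w : Fin (m + 1) → ℂ | (z', w) ∈ Z}.Finite) (w₀ : Fin (m + 1) → ℂ) :
    ∀ᶠ w in 𝓝[≠] w₀, (z', w) ∉ Z := by
  have hfin' : ({w : Fin (m + 1) → ℂ | (z', w) ∈ Z} \ {w₀}).Finite :=
    hfin.subset Set.sdiff_subset
  have h1 : ∀ᶠ w in 𝓝 w₀, w ∉ {w : Fin (m + 1) → ℂ | (z', w) ∈ Z} \ {w₀} :=
    hfin'.isClosed.isOpen_compl.mem_nhds fun hmem => hmem.2 rfl
  rw [eventually_nhdsWithin_iff]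
  filter_upwards [h1] with w hw hne hwZ
  exact hw ⟨hwZ, hne⟩

/-- **Properness of `π` on `Z` near a base point `z'₀ ∈ U'`**: given neighbourhoods `O w` of the
finitely many fibre points `w` over `z'₀`, all points of `Z` over a small ball around `z'₀` have
fibre coordinate in `⋃_w O w` (closedness over `U'`, the bound `R`, compactness).
[cite: Chirka1989, §3.1 (5), p. 29] -/
theorem exists_ball_fibre_subset_of_proper [FiniteDimensional ℂ E'] (hU' : IsOpen U')
    (hcl : ∀ x ∈ closure Z, x.1 ∈ U' → x ∈ Z) (hR : ∀ x ∈ Z, x.1 ∈ U' → ‖x.2‖ ≤ R)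
    {z'₀ : E'} (hz'₀ : z'₀ ∈ U') (O : (Fin (m + 1) → ℂ) → Set (Fin (m + 1) → ℂ))
    (hO : ∀ w, (z'₀, w) ∈ Z → O w ∈ 𝓝 w) :
    ∃ η > 0, ball z'₀ η ⊆ U' ∧ ∀ x ∈ Z, x.1 ∈ ball z'₀ η → ∃ w, (z'₀, w) ∈ Z ∧ x.2 ∈ O w := by
  classical
  obtain ⟨η₀, hη₀, hη₀U⟩ := Metric.isOpen_iff.1 hU' z'₀ hz'₀
  by_contra hcon
  push Not at hcon
  have hk : ∀ k : ℕ, ∃ x ∈ Z, x.1 ∈ ball z'₀ (min η₀ 1 / ((k : ℝ) + 1)) ∧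
      ∀ w, (z'₀, w) ∈ Z → x.2 ∉ O w := fun k =>
    hcon _ (by positivity) ((ball_subset_ball (by
      rw [div_le_iff₀ (by positivity)]
      nlinarith [min_le_left η₀ 1, (k.cast_nonneg : (0 : ℝ) ≤ k), lt_min hη₀ one_pos])).trans hη₀U)
  choose x hxZ hx1 hx2 using hk
  have hsmall : ∀ k : ℕ, min η₀ 1 / ((k : ℝ) + 1) ≤ min η₀ 1 := fun k => by
    rw [div_le_iff₀ (by positivity)]
    nlinarith [(k.cast_nonneg : (0 : ℝ) ≤ k), lt_min hη₀ one_pos]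
  have hxU : ∀ k, (x k).1 ∈ U' := fun k =>
    hη₀U (ball_subset_ball ((hsmall k).trans (min_le_left _ _)) (hx1 k))
  -- the points are bounded, hence have a convergent subsequence
  have hbd : ∀ k, x k ∈ closedBall z'₀ 1 ×ˢ closedBall (0 : Fin (m + 1) → ℂ) R := by
    intro k
    have hk1 : dist (x k).1 z'₀ ≤ 1 :=
      (mem_ball.1 (ball_subset_ball ((hsmall k).trans (min_le_right _ _)) (hx1 k))).le
    refine mk_mem_prod (mem_closedBall.2 hk1) ?_
    rw [mem_closedBall, dist_zero_right]
    exact hR _ (hxZ k) (hxU k)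
  obtain ⟨p, -, φ, hφ, hlim⟩ :=
    ((isCompact_closedBall z'₀ 1).prod (isCompact_closedBall _ _)).tendsto_subseq hbd
  -- `p.1 = z'₀`
  have hp1 : p.1 = z'₀ := by
    have h1 : Tendsto (fun k => (x (φ k)).1) atTop (𝓝 p.1) :=
      (continuous_fst.tendsto p).comp hlim
    have h2 : Tendsto (fun k => (x (φ k)).1) atTop (𝓝 z'₀) := by
      rw [tendsto_iff_dist_tendsto_zero]
      have h0 : Tendsto (fun k : ℕ => min η₀ 1 / ((k : ℝ) + 1)) atTop (𝓝 0) := by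
        simpa [div_eq_mul_inv] using tendsto_one_div_add_atTop_nhds_zero_nat.const_mul (min η₀ 1)
      refine squeeze_zero (fun k => dist_nonneg) (fun k => ?_) h0
      have := mem_ball.1 (hx1 (φ k))
      refine this.le.trans ?_
      have hle : (k : ℝ) ≤ φ k := by exact_mod_cast hφ.id_le k
      exact div_le_div_of_nonneg_left (lt_min hη₀ one_pos).le (by positivity) (by linarith)
    exact tendsto_nhds_unique h1 h2
  have hpZ : p ∈ Z := by
    refine hcl p (mem_closure_of_tendsto hlim (Eventually.of_forall fun k => hxZ (φ k))) ?_
    rw [hp1]; exact hz'₀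
  have hpw : (z'₀, p.2) ∈ Z := by rw [← hp1]; exact hpZ
  -- but `(x (φ k)).2 ∉ O p.2` for all `k`, contradicting convergence
  have h3 : Tendsto (fun k => (x (φ k)).2) atTop (𝓝 p.2) := (continuous_snd.tendsto p).comp hlim
  have h4 : ∀ᶠ k in atTop, (x (φ k)).2 ∈ O p.2 := h3 (hO p.2 hpw)
  obtain ⟨k, hk⟩ := h4.exists
  exact hx2 (φ k) p.2 hpw hk

/-! ### The local analytic cover over a base point -/

/-- **The local analytic cover over a base point** (Chirka §3.7 Thm., §4.1). In the setting of
this file (`Z` closed over the open set `U'`, cut out by holomorphic equations near its points over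
`U'`, fibre coordinates bounded by `R`), every `z'₀ ∈ U'` has a ball `V = ball z'₀ ε ⊆ U'`
carrying a holomorphic function `Δ`, nowhere locally identically zero on `V`, and a bound `K`,
such that: (i) every fibre `{w | (z', w) ∈ Z}`, `z' ∈ V`, has at most `K` points; (ii) around every
`y ∈ V` with `Δ y ≠ 0` there is a ball over which `Z` is the union of the graphs of finitely many
holomorphic maps with pairwise distinct values. Construction: local analytic covers
(`exists_coverSetup`, `CoverSetup.exists_cover_structure`) in pairwise disjoint boxes around the
finitely many fibre points over `z'₀`, properness of the projection
(`exists_ball_fibre_subset_of_proper`), and `Δ` the product of the discriminants; the cone case is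
`Literature.AlgebraicGeometry.Motives.exists_local_cover`.
[cite: Chirka1989, §3.7 Thm. and §4.1, pp. 39–43] -/
theorem exists_local_cover_of_proper [FiniteDimensional ℂ E'] (hU' : IsOpen U')
    (hcl : ∀ x ∈ closure Z, x.1 ∈ U' → x ∈ Z) (han : ∀ x ∈ Z, x.1 ∈ U' → IsZeroSetAt Z x)
    (hR : ∀ x ∈ Z, x.1 ∈ U' → ‖x.2‖ ≤ R) {z'₀ : E'} (hz'₀ : z'₀ ∈ U') :
    ∃ ε > 0, ball z'₀ ε ⊆ U' ∧ ∃ (Δ : E' → ℂ) (K : ℕ), DifferentiableOn ℂ Δ (ball z'₀ ε) ∧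
      (∀ y ∈ ball z'₀ ε, ¬ Δ =ᶠ[𝓝 y] 0) ∧
      (∀ y ∈ ball z'₀ ε, ∃ T : Finset (Fin (m + 1) → ℂ), T.card ≤ K ∧
        {w : Fin (m + 1) → ℂ | (y, w) ∈ Z} ⊆ ↑T) ∧
      ∀ y ∈ ball z'₀ ε, Δ y ≠ 0 →
        ∃ δ > 0, ∃ (k : ℕ) (τ : Fin k → E' → (Fin (m + 1) → ℂ)),
        (∀ j, DifferentiableOn ℂ (τ j) (ball y δ)) ∧
        (∀ y' ∈ ball y δ, ∀ j j', j ≠ j' → τ j y' ≠ τ j' y') ∧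
        ∀ y' ∈ ball y δ, ∀ w, (y', w) ∈ Z ↔ ∃ j, w = τ j y' := by
  classical
  -- the finite fibre over `z'₀`
  have hfin : {w : Fin (m + 1) → ℂ | (z'₀, w) ∈ Z}.Finite := fibre_finite_of_proper hcl han hR hz'₀
  set F₀ : Finset (Fin (m + 1) → ℂ) := hfin.toFinset with hF₀
  have hmemF₀ : ∀ w, w ∈ F₀ ↔ (z'₀, w) ∈ Z := fun w => by simp [hF₀]
  -- separation radius
  obtain ⟨η, hη, hdisj⟩ := exists_pairwiseDisjoint_ball hfin
  -- local equations at the fibre points, inside the separating balls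
  have hloc : ∀ a : F₀, ∃ (W : Set (E' × (Fin (m + 1) → ℂ))) (N : ℕ)
      (f : E' × (Fin (m + 1) → ℂ) → (Fin N → ℂ)), IsOpen W ∧
      ((z'₀, (a : Fin (m + 1) → ℂ)) : E' × (Fin (m + 1) → ℂ)) ∈ W ∧
      W ⊆ univ ×ˢ ball (a : Fin (m + 1) → ℂ) η ∧
      DifferentiableOn ℂ f W ∧ Z ∩ W = W ∩ f ⁻¹' {0} := by
    intro a
    have haZ : (z'₀, (a : Fin (m + 1) → ℂ)) ∈ Z := (hmemF₀ a).1 a.2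
    obtain ⟨W, hW, hxW, N, f, hf, hZW⟩ := han _ haZ hz'₀
    refine ⟨W ∩ univ ×ˢ ball (a : Fin (m + 1) → ℂ) η, N, f,
      hW.inter (isOpen_univ.prod isOpen_ball), ⟨hxW, mem_univ _, mem_ball_self hη⟩,
      inter_subset_right, hf.mono inter_subset_left, ?_⟩
    rw [← inter_assoc, hZW]
    ext x
    simp only [mem_inter_iff, mem_preimage]
    tauto
  choose W N f hWo hxW hWsub hf hZW using hloc
  -- isolation of the fibre points
  have hiso : ∀ a : F₀, ∀ᶠ w in 𝓝[≠] (a : Fin (m + 1) → ℂ), f a (z'₀, w) ≠ 0 := by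
    intro a
    have h1 := eventually_notMem_fibre_of_finite hfin (a : Fin (m + 1) → ℂ)
    have h2 : ∀ᶠ w in 𝓝 (a : Fin (m + 1) → ℂ), ((z'₀, w) : E' × (Fin (m + 1) → ℂ)) ∈ W a := by
      have hc : Continuous fun w : Fin (m + 1) → ℂ => ((z'₀, w) : E' × (Fin (m + 1) → ℂ)) := by
        fun_prop
      exact hc.continuousAt.eventually ((hWo a).mem_nhds (hxW a))
    filter_upwards [h1, mem_nhdsWithin_of_mem_nhds h2] with w hw1 hw2 hf0
    exact hw1 (((hZW a).symm.subset ⟨hw2, hf0⟩).1)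
  -- the local analytic covers
  have hcov : ∀ a : F₀, ∃ (ε r C' : ℝ) (Fs : Fin (m + 1) → E' × ℂ → ℂ)
      (rr RR : Fin (m + 1) → ℝ), CoverSetup (f a) z'₀ (a : Fin (m + 1) → ℂ) ε r C' Fs rr RR ∧
        ball z'₀ ε ×ˢ closedBall (a : Fin (m + 1) → ℂ) r ⊆ W a := fun a =>
    exists_coverSetup (hWo a) (hf a) (a := (z'₀, (a : Fin (m + 1) → ℂ))) (hxW a) (hiso a)
  choose ε r C' Fs rr RR hS hboxW using hcov
  have hrη : ∀ a : F₀, closedBall (a : Fin (m + 1) → ℂ) (r a) ⊆ ball (a : Fin (m + 1) → ℂ) η := by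
    intro a w hw
    have : ((z'₀, w) : E' × (Fin (m + 1) → ℂ)) ∈ W a :=
      hboxW a (mk_mem_prod (mem_ball_self (hS a).ε_pos) hw)
    exact (hWsub a this).2
  -- discriminants
  choose Δ hΔd hΔne hΔcov using fun a : F₀ => (hS a).exists_cover_structure
  -- properness: a base ball inside `U'` over which all of `Z` lies in the open boxes
  obtain ⟨ε₁, hε₁, hε₁U, hprop⟩ := exists_ball_fibre_subset_of_proper hU' hcl hR hz'₀
    (fun w => if hw : (z'₀, w) ∈ Z then ball w (r ⟨w, (hmemF₀ w).2 hw⟩) else univ) (by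
      intro w hw
      rw [dif_pos hw]
      exact ball_mem_nhds _ (hS ⟨w, (hmemF₀ w).2 hw⟩).r_pos)
  -- the base ball
  obtain ⟨ε₀, hε₀, hε₀₁, hε₀a⟩ :=
    exists_pos_le_forall (ι := F₀) (g := fun a => ε a) (fun a => (hS a).ε_pos) hε₁
  have hballa : ∀ a : F₀, ball z'₀ ε₀ ⊆ ball z'₀ (ε a) := fun a => ball_subset_ball (hε₀a a)
  -- over the base ball, `Z` lies in the open boxes
  have hZbox : ∀ x ∈ Z, x.1 ∈ ball z'₀ ε₀ →
      ∃ a : F₀, x.2 ∈ ball (a : Fin (m + 1) → ℂ) (r a) := by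
    intro x hx hx1
    obtain ⟨w, hw, hxw⟩ := hprop x hx (ball_subset_ball hε₀₁ hx1)
    rw [dif_pos hw] at hxw
    exact ⟨⟨w, (hmemF₀ w).2 hw⟩, hxw⟩
  -- in the boxes, `Z` is the zero set of the local equations
  have hZiff : ∀ (a : F₀) (x : E' × (Fin (m + 1) → ℂ)), x.1 ∈ ball z'₀ (ε a) →
      x.2 ∈ closedBall (a : Fin (m + 1) → ℂ) (r a) → (x ∈ Z ↔ f a x = 0) := by
    intro a x hx1 hx2
    have hxW : x ∈ W a := hboxW a (mk_mem_prod hx1 hx2)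
    constructor
    · intro hx
      have := (hZW a).subset ⟨hx, hxW⟩
      simpa using this.2
    · intro hfx
      exact ((hZW a).symm.subset ⟨hxW, by simpa using hfx⟩).1
  have hΔd' : ∀ a : F₀, DifferentiableOn ℂ (Δ a) (ball z'₀ ε₀) := fun a =>
    (hΔd a).mono (hballa a)
  have hPd : DifferentiableOn ℂ (fun y => ∏ a ∈ F₀.attach, Δ a y) (ball z'₀ ε₀) :=
    differentiableOn_finset_prod_base _ fun a _ => hΔd' a
  refine ⟨ε₀, hε₀, (ball_subset_ball hε₀₁).trans hε₁U, fun y => ∏ a ∈ F₀.attach, Δ a y,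
    ∑ a ∈ F₀.attach, (hS a).boxBound, hPd, ?_, ?_, ?_⟩
  · -- `Δ` is nowhere locally identically zero on the base ball
    intro y hy hzero
    obtain ⟨z₁, hz₁, hz₁ne⟩ := exists_forall_ne_zero_of_not_eventuallyEq F₀.attach isOpen_ball
      ⟨z'₀, mem_ball_self hε₀⟩ (fun a _ => (hΔd' a).continuousOn)
      (fun a _ z hz => hΔne a z (hballa a hz))
    have hprod : (fun y => ∏ a ∈ F₀.attach, Δ a y) z₁ ≠ 0 :=
      Finset.prod_ne_zero_iff.2 fun a ha => hz₁ne a ha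
    exact hprod (eqOn_zero_of_preconnected_of_eventuallyEq_zero hPd isOpen_ball
      (convex_ball _ _).isPreconnected hy hzero hz₁)
  · -- the fibres over the base ball have at most `K` points
    intro y hy
    refine ⟨F₀.attach.biUnion fun a => rootBox (Fs a) (a : Fin (m + 1) → ℂ) (rr a) y, ?_, ?_⟩
    · exact Finset.card_biUnion_le.trans
        (Finset.sum_le_sum fun a _ => (hS a).card_rootBox_le (hballa a hy))
    · intro w hw
      obtain ⟨a, ha⟩ := hZbox (y, w) hw hy
      refine Finset.mem_coe.2 (Finset.mem_biUnion.2 ⟨a, Finset.mem_attach _ a, ?_⟩)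
      have hx : ((y, w) : E' × (Fin (m + 1) → ℂ)) ∈
          ball z'₀ (ε a) ×ˢ closedBall (a : Fin (m + 1) → ℂ) (r a) :=
        mk_mem_prod (hballa a hy) (ball_subset_closedBall ha)
      exact (hS a).mem_rootBox_of_zero (x := (y, w)) hx
        ((hZiff a (y, w) (hballa a hy) (ball_subset_closedBall ha)).1 hw)
  · -- sheets near a good point
    intro y hy hΔy
    have hΔy' : ∀ a : F₀, Δ a y ≠ 0 := fun a =>
      (Finset.prod_ne_zero_iff.1 hΔy) a (Finset.mem_attach _ a)
    choose δ hδ hδball n σ hσd hσne hσbox hσiff using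
      fun a : F₀ => hΔcov a y (hballa a hy) (hΔy' a)
    have hyε : 0 < ε₀ - dist y z'₀ := by rw [mem_ball] at hy; linarith
    obtain ⟨δ₀, hδ₀, hδ₀y, hδ₀a⟩ :=
      exists_pos_le_forall (ι := F₀) (g := fun a => δ a) (fun a => hδ a) hyε
    have hball0 : ball y δ₀ ⊆ ball z'₀ ε₀ := ball_subset_ball' (by linarith)
    have hballδ : ∀ a : F₀, ball y δ₀ ⊆ ball y (δ a) := fun a => ball_subset_ball (hδ₀a a)
    -- values of the sheets of box `a` lie in the separating ball of `a`
    have hσball : ∀ (a : F₀) (y' : E'), y' ∈ ball y δ₀ → ∀ i,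
        σ a i y' ∈ ball (a : Fin (m + 1) → ℂ) (r a) := fun a y' hy' i =>
      (hS a).mem_ball_of_mem_box (hσbox a y' (hballδ a hy') i)
    -- index the sheets by a `Fin` type
    set ι := Σ a : F₀, Fin (n a) with hι
    set e : ι ≃ Fin (Fintype.card ι) := Fintype.equivFin ι with he
    have key : ∀ y' ∈ ball y δ₀, ∀ p q : ι, p ≠ q → σ p.1 p.2 y' ≠ σ q.1 q.2 y' := by
      rintro y' hy' ⟨a, i⟩ ⟨a', i'⟩ hpq heq
      by_cases h1 : a = a'
      · subst h1
        exact hσne a y' (hballδ a hy') i i' (fun hii' => hpq (by rw [hii'])) heq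
      · have hne' : ((a : F₀) : Fin (m + 1) → ℂ) ≠ (a' : Fin (m + 1) → ℂ) :=
          fun h => h1 (Subtype.ext h)
        have hma : σ a i y' ∈ ball ((a : F₀) : Fin (m + 1) → ℂ) η :=
          hrη a (ball_subset_closedBall (hσball a y' hy' i))
        have hma' : σ a' i' y' ∈ ball ((a' : F₀) : Fin (m + 1) → ℂ) η :=
          hrη a' (ball_subset_closedBall (hσball a' y' hy' i'))
        rw [heq] at hma
        exact Set.disjoint_left.1 (hdisj _ ((hmemF₀ _).1 a.2) _ ((hmemF₀ _).1 a'.2) hne')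
          hma hma'
    refine ⟨δ₀, hδ₀, Fintype.card ι, fun j y' => σ (e.symm j).1 (e.symm j).2 y', ?_, ?_, ?_⟩
    · intro j
      exact (hσd _ _).mono (hballδ _)
    · intro y' hy' j j' hjj'
      exact key y' hy' _ _ fun h => hjj' (e.symm.injective h)
    · intro y' hy' w
      have hy'0 : y' ∈ ball z'₀ ε₀ := hball0 hy'
      constructor
      · intro hw
        obtain ⟨a, ha⟩ := hZbox (y', w) hw hy'0
        have hf0 : f a (y', w) = 0 :=
          (hZiff a (y', w) (hballa a hy'0) (ball_subset_closedBall ha)).1 hw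
        obtain ⟨i, hi⟩ := (hσiff a y' (hballδ a hy') w (ball_subset_closedBall ha)).1 hf0
        have hgen : ∀ p : ι, p = ⟨a, i⟩ → w = σ p.1 p.2 y' := by
          rintro p rfl; exact hi
        exact ⟨e ⟨a, i⟩, hgen _ (Equiv.symm_apply_apply e _)⟩
      · rintro ⟨j, rfl⟩
        have hbox := hσball (e.symm j).1 y' hy' (e.symm j).2
        have hf0 : f (e.symm j).1 (y', σ (e.symm j).1 (e.symm j).2 y') = 0 :=
          (hσiff (e.symm j).1 y' (hballδ _ hy') _ (ball_subset_closedBall hbox)).2 ⟨_, rfl⟩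
        exact (hZiff (e.symm j).1 (y', _) (hballa _ hy'0) (ball_subset_closedBall hbox)).2 hf0

/-! ### The unramified part `G` of the projection -/

section Good

variable {G : Set E'}

omit [NormedSpace ℂ E'] in
/-- **`G` is open.** [cite: Chirka1989, §4.1, p. 42] -/
theorem isOpen_good [NormedSpace ℂ E'] (hU' : IsOpen U')
    (hG : ∀ z', z' ∈ G ↔ z' ∈ U' ∧ ∃ δ > 0, ∃ (k : ℕ) (τ : Fin k → E' → (Fin (m + 1) → ℂ)),
      (∀ j, DifferentiableOn ℂ (τ j) (ball z' δ)) ∧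
      (∀ y ∈ ball z' δ, ∀ j j', j ≠ j' → τ j y ≠ τ j' y) ∧
      ∀ y ∈ ball z' δ, ∀ w, (y, w) ∈ Z ↔ ∃ j, w = τ j y) :
    IsOpen G := by
  rw [isOpen_iff_mem_nhds]
  intro z' hz'
  obtain ⟨hz'U, δ, hδ, k, τ, hτd, hτne, hτZ⟩ := (hG z').1 hz'
  filter_upwards [hU'.mem_nhds hz'U, ball_mem_nhds z' hδ] with y hyU hy
  obtain ⟨hpos, h1, h2, h3⟩ := sheets_restrict hy hτd hτne hτZ
  exact (hG y).2 ⟨hyU, _, hpos, k, τ, h1, h2, h3⟩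

/-- **The complement of `G` is thin**: every `z'₀ ∈ U'` has a ball in `U'` carrying a holomorphic
`Δ`, not identically zero near any of its points, whose non-vanishing at a point `y` of the ball
forces `y ∈ G` (the discriminant of the local analytic cover `exists_local_cover_of_proper`).
[cite: Chirka1989, §4.1, p. 42] -/
theorem exists_thin_good_of_proper [FiniteDimensional ℂ E'] (hU' : IsOpen U')
    (hcl : ∀ x ∈ closure Z, x.1 ∈ U' → x ∈ Z) (han : ∀ x ∈ Z, x.1 ∈ U' → IsZeroSetAt Z x)
    (hR : ∀ x ∈ Z, x.1 ∈ U' → ‖x.2‖ ≤ R)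
    (hG : ∀ z', z' ∈ G ↔ z' ∈ U' ∧ ∃ δ > 0, ∃ (k : ℕ) (τ : Fin k → E' → (Fin (m + 1) → ℂ)),
      (∀ j, DifferentiableOn ℂ (τ j) (ball z' δ)) ∧
      (∀ y ∈ ball z' δ, ∀ j j', j ≠ j' → τ j y ≠ τ j' y) ∧
      ∀ y ∈ ball z' δ, ∀ w, (y, w) ∈ Z ↔ ∃ j, w = τ j y)
    {z'₀ : E'} (hz'₀ : z'₀ ∈ U') :
    ∃ ε > 0, ball z'₀ ε ⊆ U' ∧ ∃ Δ : E' → ℂ, DifferentiableOn ℂ Δ (ball z'₀ ε) ∧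
      (∀ y ∈ ball z'₀ ε, ¬ Δ =ᶠ[𝓝 y] 0) ∧ ∀ y ∈ ball z'₀ ε, Δ y ≠ 0 → y ∈ G := by
  obtain ⟨ε, hε, hεU, Δ, K, hΔd, hΔne, -, hgood⟩ := exists_local_cover_of_proper hU' hcl han hR hz'₀
  exact ⟨ε, hε, hεU, Δ, hΔd, hΔne, fun y hy hΔy => (hG y).2 ⟨hεU hy, hgood y hy hΔy⟩⟩

/-- **`U'` lies in the closure of `G`** (`Δ ≢ 0` near each of its points: the complement of `G`
is nowhere dense). [cite: Chirka1989, §4.1, p. 42] -/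
theorem mem_closure_good_of_proper [FiniteDimensional ℂ E'] (hU' : IsOpen U')
    (hcl : ∀ x ∈ closure Z, x.1 ∈ U' → x ∈ Z) (han : ∀ x ∈ Z, x.1 ∈ U' → IsZeroSetAt Z x)
    (hR : ∀ x ∈ Z, x.1 ∈ U' → ‖x.2‖ ≤ R)
    (hG : ∀ z', z' ∈ G ↔ z' ∈ U' ∧ ∃ δ > 0, ∃ (k : ℕ) (τ : Fin k → E' → (Fin (m + 1) → ℂ)),
      (∀ j, DifferentiableOn ℂ (τ j) (ball z' δ)) ∧
      (∀ y ∈ ball z' δ, ∀ j j', j ≠ j' → τ j y ≠ τ j' y) ∧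
      ∀ y ∈ ball z' δ, ∀ w, (y, w) ∈ Z ↔ ∃ j, w = τ j y)
    {z'₀ : E'} (hz'₀ : z'₀ ∈ U') : z'₀ ∈ closure G := by
  obtain ⟨ε, hε, -, Δ, -, hΔne, hgood⟩ := exists_thin_good_of_proper hU' hcl han hR hG hz'₀
  rw [mem_closure_iff_frequently]
  have hfr : ∃ᶠ y in 𝓝 z'₀, Δ y ≠ 0 := by
    have := hΔne z'₀ (mem_ball_self hε)
    simpa [Filter.EventuallyEq, Filter.not_eventually] using this
  exact (hfr.and_eventually (ball_mem_nhds z'₀ hε)).mono fun y hy => hgood y hy.2 hy.1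

/-- **Uniform bound for the fibres over a compact set**: over a compact `K' ⊆ U'` there is `K`
such that every fibre `{w | (z', w) ∈ Z}`, `z' ∈ K'`, has at most `K` points (local bounds from
`exists_local_cover_of_proper` and a finite subcover). [cite: Chirka1989, §3.7 Thm., p. 40] -/
theorem exists_forall_fibre_card_le_of_proper [FiniteDimensional ℂ E'] (hU' : IsOpen U')
    (hcl : ∀ x ∈ closure Z, x.1 ∈ U' → x ∈ Z) (han : ∀ x ∈ Z, x.1 ∈ U' → IsZeroSetAt Z x)
    (hR : ∀ x ∈ Z, x.1 ∈ U' → ‖x.2‖ ≤ R) {K' : Set E'} (hK' : IsCompact K') (hK'U : K' ⊆ U') :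
    ∃ K : ℕ, ∀ z' ∈ K', ∃ T : Finset (Fin (m + 1) → ℂ), T.card ≤ K ∧ {w | (z', w) ∈ Z} ⊆ ↑T := by
  classical
  have hloc : ∀ z' : K', ∃ ε > 0, ∃ K : ℕ, ∀ y ∈ ball (z' : E') ε,
      ∃ T : Finset (Fin (m + 1) → ℂ), T.card ≤ K ∧ {w | (y, w) ∈ Z} ⊆ ↑T := by
    intro z'
    obtain ⟨ε, hε, -, Δ, K, -, -, hK, -⟩ := exists_local_cover_of_proper hU' hcl han hR (hK'U z'.2)
    exact ⟨ε, hε, K, hK⟩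
  choose ε hε K hK using hloc
  obtain ⟨t, ht⟩ := hK'.elim_finite_subcover (fun z' : K' => ball (z' : E') (ε z'))
    (fun z' => isOpen_ball) (fun z' hz' => mem_iUnion.2 ⟨⟨z', hz'⟩, mem_ball_self (hε _)⟩)
  refine ⟨t.sup K, fun z' hz' => ?_⟩
  obtain ⟨a, hat, hau⟩ : ∃ a ∈ t, z' ∈ ball (a : E') (ε a) := by
    simpa only [mem_iUnion, exists_prop] using ht hz'
  obtain ⟨T, hTcard, hTsub⟩ := hK a z' hau
  exact ⟨T, hTcard.trans (Finset.le_sup hat), hTsub⟩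

/-- **The part of `Z` over `G ∩ V'` is a cover piece** in the sense of
`Literature.Analysis.Complex.SCV.CoverPiece`, for every open `V' ⊆ U'` over which the fibres have
uniformly at most `K` points (base `V'`, thin complement by `exists_thin_good_of_proper`, fibre
coordinates bounded by `R`, at most `K` sheets). [cite: Chirka1989, §4.1, pp. 42–43] -/
theorem coverPiece_good_of_proper [FiniteDimensional ℂ E'] (hU' : IsOpen U')
    (hcl : ∀ x ∈ closure Z, x.1 ∈ U' → x ∈ Z) (han : ∀ x ∈ Z, x.1 ∈ U' → IsZeroSetAt Z x)
    (hR : ∀ x ∈ Z, x.1 ∈ U' → ‖x.2‖ ≤ R)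
    (hG : ∀ z', z' ∈ G ↔ z' ∈ U' ∧ ∃ δ > 0, ∃ (k : ℕ) (τ : Fin k → E' → (Fin (m + 1) → ℂ)),
      (∀ j, DifferentiableOn ℂ (τ j) (ball z' δ)) ∧
      (∀ y ∈ ball z' δ, ∀ j j', j ≠ j' → τ j y ≠ τ j' y) ∧
      ∀ y ∈ ball z' δ, ∀ w, (y, w) ∈ Z ↔ ∃ j, w = τ j y)
    {V' : Set E'} (hV' : IsOpen V') (hV'U : V' ⊆ U') {K : ℕ}
    (hK : ∀ z' ∈ V', ∃ T : Finset (Fin (m + 1) → ℂ), T.card ≤ K ∧ {w | (z', w) ∈ Z} ⊆ ↑T) :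
    CoverPiece {x : E' × (Fin (m + 1) → ℂ) | x ∈ Z ∧ x.1 ∈ G ∩ V'} V' (G ∩ V') K R where
  isOpen_base := hV'
  isOpen := (isOpen_good hU' hG).inter hV'
  subset := inter_subset_right
  thin := by
    rintro z ⟨hzV, hzG⟩
    obtain ⟨ε, hε, -, Δ, hΔd, hΔne, hgood⟩ :=
      exists_thin_good_of_proper hU' hcl han hR hG (hV'U hzV)
    refine ⟨Δ, ball z ε ∩ V', isOpen_ball.inter hV', ⟨mem_ball_self hε, hzV⟩, inter_subset_right,
      hΔd.mono inter_subset_left, ?_, hΔne z (mem_ball_self hε)⟩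
    rintro x ⟨⟨hxV, hxG⟩, hxball, -⟩
    by_contra hΔx
    exact hxG ⟨hgood x hxball hΔx, hxV⟩
  fst_mem := fun x hx => hx.2
  norm_le := by
    rintro x ⟨hxZ, -, hxV⟩
    exact hR x hxZ (hV'U hxV)
  sheets := by
    rintro z₀ ⟨hz₀G, hz₀V⟩
    obtain ⟨-, δ, hδ, k, τ, hτd, hτne, hτZ⟩ := (hG z₀).1 hz₀G
    -- a ball around `z₀` inside `G ∩ V'`
    obtain ⟨δ₁, hδ₁, hδ₁V⟩ := Metric.isOpen_iff.1 hV' z₀ hz₀V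
    set δ₀ := min δ δ₁ with hδ₀
    have hδ₀pos : 0 < δ₀ := lt_min hδ hδ₁
    have hδ₀δ : ball z₀ δ₀ ⊆ ball z₀ δ := ball_subset_ball (min_le_left _ _)
    have hballV : ball z₀ δ₀ ⊆ V' := (ball_subset_ball (min_le_right _ _)).trans hδ₁V
    have hballG : ball z₀ δ₀ ⊆ G := by
      intro y hy
      obtain ⟨hpos, h1, h2, h3⟩ := sheets_restrict (hδ₀δ hy) hτd hτne hτZ
      exact (hG y).2 ⟨hV'U (hballV hy), _, hpos, k, τ, h1, h2, h3⟩
    -- the number of sheets is the cardinality of the fibre over `z₀`, at most `K`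
    have hkK : k ≤ K := by
      obtain ⟨T, hTcard, hTsub⟩ := hK z₀ hz₀V
      have hinj : Function.Injective fun j => τ j z₀ := fun j j' h => by
        by_contra hjj'; exact hτne z₀ (mem_ball_self hδ) j j' hjj' h
      have hsub : (Finset.univ.image fun j => τ j z₀) ⊆ T := by
        intro w hw
        obtain ⟨j, -, rfl⟩ := Finset.mem_image.1 hw
        exact hTsub ((hτZ z₀ (mem_ball_self hδ) _).2 ⟨j, rfl⟩)
      have := Finset.card_le_card hsub
      rw [Finset.card_image_of_injective _ hinj, Finset.card_univ, Fintype.card_fin] at this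
      exact this.trans hTcard
    refine ⟨δ₀, hδ₀pos, fun y hy => ⟨hballG hy, hballV hy⟩, k, τ, hkK,
      fun j => (hτd j).mono hδ₀δ, fun y hy => hτne y (hδ₀δ hy), fun y hy w => ?_⟩
    rw [← hτZ y (hδ₀δ hy) w]
    exact ⟨fun hx => hx.1, fun hx => ⟨hx, hballG hy, hballV hy⟩⟩

/-! ### Regular points and the density of the part over `G` -/

omit [NormedSpace ℂ E'] in
/-- **Points of `Z` over `G` are regular of codimension `m + 1`**: near such a point `Z` is the
graph `w = τ j (z')` of a single holomorphic sheet, cut out by the `m + 1` equations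
`w - τ j (z') = 0` with surjective differential ("an analytic cover is a complex manifold over
its regular part"). [cite: Chirka1989, §4.1, p. 42, and §2.3] -/
theorem isRegPt_of_mem_good [NormedSpace ℂ E']
    (hG : ∀ z', z' ∈ G ↔ z' ∈ U' ∧ ∃ δ > 0, ∃ (k : ℕ) (τ : Fin k → E' → (Fin (m + 1) → ℂ)),
      (∀ j, DifferentiableOn ℂ (τ j) (ball z' δ)) ∧
      (∀ y ∈ ball z' δ, ∀ j j', j ≠ j' → τ j y ≠ τ j' y) ∧
      ∀ y ∈ ball z' δ, ∀ w, (y, w) ∈ Z ↔ ∃ j, w = τ j y)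
    {x : E' × (Fin (m + 1) → ℂ)} (hxZ : x ∈ Z) (hxG : x.1 ∈ G) : IsRegPt Z (m + 1) x := by
  classical
  obtain ⟨-, δ, hδ, k, τ, hτd, hτne, hτZ⟩ := (hG x.1).1 hxG
  obtain ⟨j, hj⟩ := (hτZ x.1 (mem_ball_self hδ) x.2).1 (by simpa using hxZ)
  -- separation of the sheet values at `x.1`
  obtain ⟨η, hη, -, hηle⟩ := exists_pos_le_forall (ι := {j' : Fin k // j' ≠ j})
    (g := fun j' => dist (τ j' x.1) (τ j x.1))
    (fun j' => dist_pos.2 (hτne x.1 (mem_ball_self hδ) _ _ j'.2)) one_pos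
  -- continuity of the sheets at `x.1`
  have hcont : ∀ j', ∃ δ' > 0, ∀ y ∈ ball x.1 δ', dist (τ j' y) (τ j' x.1) < η / 2 := by
    intro j'
    have hc : ContinuousAt (τ j') x.1 :=
      (hτd j').continuousOn.continuousAt (isOpen_ball.mem_nhds (mem_ball_self hδ))
    obtain ⟨δ', hδ', h⟩ := Metric.continuousAt_iff.1 hc (η / 2) (by positivity)
    exact ⟨δ', hδ', fun y hy => h hy⟩
  choose δj hδj hδjcont using hcont
  obtain ⟨δ', hδ', hδ'δ, hδ'j⟩ := exists_pos_le_forall (ι := Fin k) (g := δj) hδj hδ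
  set U : Set (E' × (Fin (m + 1) → ℂ)) := ball x.1 δ' ×ˢ ball x.2 (η / 2) with hU
  have hUo : IsOpen U := isOpen_ball.prod isOpen_ball
  have hxU : x ∈ U := mk_mem_prod (mem_ball_self hδ') (mem_ball_self (by positivity))
  have hball : ball x.1 δ' ⊆ ball x.1 δ := ball_subset_ball hδ'δ
  -- the equations `w - τ j z' = 0`
  set g : E' × (Fin (m + 1) → ℂ) → (Fin (m + 1) → ℂ) := fun y => y.2 - τ j y.1 with hg
  have hgd : DifferentiableOn ℂ g U :=
    differentiableOn_snd.sub ((hτd j).comp differentiableOn_fst fun y hy => hball hy.1)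
  refine ⟨U, hUo, hxU, g, hgd, ?_, ?_⟩
  · ext y
    simp only [mem_inter_iff, mem_preimage, mem_singleton_iff, hg, sub_eq_zero]
    constructor
    · rintro ⟨hyZ, hyU⟩
      refine ⟨hyU, ?_⟩
      obtain ⟨j', hj'⟩ := (hτZ y.1 (hball hyU.1) y.2).1 (by simpa using hyZ)
      by_cases hjj : j' = j
      · rw [hj', hjj]
      · exfalso
        have h1 : η ≤ dist (τ j' x.1) (τ j x.1) := hηle ⟨j', hjj⟩
        have h2 : dist (τ j' y.1) (τ j' x.1) < η / 2 :=
          hδjcont j' y.1 (ball_subset_ball (hδ'j j') hyU.1)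
        have h3 : dist y.2 x.2 < η / 2 := hyU.2
        rw [hj', hj] at h3
        have := dist_triangle (τ j' x.1) (τ j' y.1) (τ j x.1)
        rw [dist_comm (τ j' x.1) (τ j' y.1)] at this
        linarith
    · rintro ⟨hyU, hy⟩
      refine ⟨?_, hyU⟩
      have := (hτZ y.1 (hball hyU.1) y.2).2 ⟨j, hy⟩
      simpa using this
  · -- surjectivity of the differential
    have hτj : HasFDerivAt (τ j) (fderiv ℂ (τ j) x.1) x.1 :=
      ((hτd j).differentiableAt (isOpen_ball.mem_nhds (mem_ball_self hδ))).hasFDerivAt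
    have hgder : HasFDerivAt g (ContinuousLinearMap.snd ℂ E' (Fin (m + 1) → ℂ) -
        (fderiv ℂ (τ j) x.1).comp (ContinuousLinearMap.fst ℂ E' (Fin (m + 1) → ℂ))) x :=
      hasFDerivAt_snd.sub (hτj.comp x hasFDerivAt_fst)
    rw [hgder.fderiv]
    intro v
    exact ⟨(0, v), by simp⟩

/-- **Key lemma: regular points of codimension `m + 1` of `Z` over `U'` lie in the closure of the
part of `Z` over `G`.** Near such a point `b`, `Z` is an injectively parametrised complex manifold
of dimension `dim E'` (`IsRegPt.exists_param`) on which the projection `π` has finite fibres; by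
`exists_map_nhds_eq_of_isolated` the projection is open at some point of any neighbourhood of `b`
in `Z`, so if that neighbourhood avoided `π⁻¹(G)` the discriminant `Δ` of
`exists_thin_good_of_proper` (which vanishes at base points off `G`) would vanish on an open set,
contradicting `Δ ≢ 0`. The cone case is
`Literature.AlgebraicGeometry.Motives.mem_closure_good_of_isRegPt`.
[cite: Chirka1989, §4.4 (proof of the Remmert–Stein theorem), p. 48] -/
theorem mem_closure_good_of_isRegPt_of_proper [FiniteDimensional ℂ E'] (hU' : IsOpen U')
    (hcl : ∀ x ∈ closure Z, x.1 ∈ U' → x ∈ Z) (han : ∀ x ∈ Z, x.1 ∈ U' → IsZeroSetAt Z x)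
    (hR : ∀ x ∈ Z, x.1 ∈ U' → ‖x.2‖ ≤ R)
    (hG : ∀ z', z' ∈ G ↔ z' ∈ U' ∧ ∃ δ > 0, ∃ (k : ℕ) (τ : Fin k → E' → (Fin (m + 1) → ℂ)),
      (∀ j, DifferentiableOn ℂ (τ j) (ball z' δ)) ∧
      (∀ y ∈ ball z' δ, ∀ j j', j ≠ j' → τ j y ≠ τ j' y) ∧
      ∀ y ∈ ball z' δ, ∀ w, (y, w) ∈ Z ↔ ∃ j, w = τ j y)
    {b : E' × (Fin (m + 1) → ℂ)} (hbZ : b ∈ Z) (hbU : b.1 ∈ U') (hreg : IsRegPt Z (m + 1) b) :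
    b ∈ closure {x : E' × (Fin (m + 1) → ℂ) | x ∈ Z ∧ x.1 ∈ G} := by
  classical
  obtain ⟨ε, hε, hεU, Δ, hΔd, hΔne, hgood⟩ := exists_thin_good_of_proper hU' hcl han hR hG hbU
  by_contra hbcl
  -- a neighbourhood of `b` missing `Z ∩ π⁻¹ G`
  obtain ⟨N₀, hN₀, hN₀T⟩ : ∃ N₀ ∈ 𝓝 b, ∀ y ∈ N₀, ¬ (y ∈ Z ∧ y.1 ∈ G) := by
    rw [mem_closure_iff_nhds] at hbcl
    push Not at hbcl
    obtain ⟨t, ht, hte⟩ := hbcl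
    refine ⟨t, ht, fun y hy hyT => ?_⟩
    have : y ∈ t ∩ {x | x ∈ Z ∧ x.1 ∈ G} := ⟨hy, hyT⟩
    rw [hte] at this
    exact this
  -- parametrisation of `Z` near `b`, inside `N₀ ∩ π⁻¹ (ball b.1 ε)`
  set N₁ : Set (E' × (Fin (m + 1) → ℂ)) := N₀ ∩ Prod.fst ⁻¹' ball b.1 ε with hN₁
  have hN₁ : N₁ ∈ 𝓝 b := Filter.inter_mem hN₀
    (continuous_fst.continuousAt.preimage_mem_nhds (isOpen_ball.mem_nhds (mem_ball_self hε)))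
  obtain ⟨N, K, ρ, Ψ₀, hNo, hbN, hNN₁, hρ, hdim, hΨd, hΨinj, hΨim⟩ := hreg.exists_param hbZ hN₁
  have hdimK : Module.finrank ℂ K = Module.finrank ℂ E' := by
    have : Module.finrank ℂ (E' × (Fin (m + 1) → ℂ)) = Module.finrank ℂ E' + (m + 1) := by
      rw [Module.finrank_prod, Module.finrank_fin_fun]
    rw [this] at hdim
    omega
  -- the projection restricted to the parametrised piece
  set f : K → E' := fun u => (Ψ₀ u).1 with hf
  have hfd : DifferentiableOn ℂ f (ball 0 ρ) := differentiableOn_fst.comp hΨd (mapsTo_univ _ _)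
  have hΨmem : ∀ u ∈ ball (0 : K) ρ, Ψ₀ u ∈ Z ∧ Ψ₀ u ∈ N := fun u hu => by
    have : Ψ₀ u ∈ Z ∩ N := hΨim ▸ mem_image_of_mem Ψ₀ hu
    exact ⟨this.1, this.2⟩
  have hfmem : ∀ u ∈ ball (0 : K) ρ, f u ∈ ball b.1 ε := fun u hu => (hNN₁ (hΨmem u hu).2).2
  -- the fibres of `f` in the ball are finite, hence discrete
  have hiso' : ∀ u ∈ ball (0 : K) ρ, ∀ᶠ v in 𝓝[≠] u, f v ≠ f u := by
    intro u hu
    have hfin : {w : Fin (m + 1) → ℂ | (f u, w) ∈ Z}.Finite :=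
      fibre_finite_of_proper hcl han hR (hεU (hfmem u hu))
    have hA : {v : K | v ∈ ball (0 : K) ρ ∧ f v = f u}.Finite := by
      refine Set.Finite.of_finite_image ?_ (hΨinj.mono fun v hv => hv.1)
      refine (hfin.image fun w => ((f u, w) : E' × (Fin (m + 1) → ℂ))).subset ?_
      rintro _ ⟨v, ⟨hv, hfv⟩, rfl⟩
      refine ⟨(Ψ₀ v).2, ?_, ?_⟩
      · show (f u, (Ψ₀ v).2) ∈ Z
        rw [← hfv]; exact (hΨmem v hv).1
      · rw [← hfv]
    have hcl' : IsClosed ({v : K | v ∈ ball (0 : K) ρ ∧ f v = f u} \ {u}) :=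
      (hA.subset Set.sdiff_subset).isClosed
    have h1 : ({v : K | v ∈ ball (0 : K) ρ ∧ f v = f u} \ {u})ᶜ ∈ 𝓝 u :=
      hcl'.isOpen_compl.mem_nhds fun h => h.2 rfl
    filter_upwards [mem_nhdsWithin_of_mem_nhds h1, mem_nhdsWithin_of_mem_nhds
      (isOpen_ball.mem_nhds hu), self_mem_nhdsWithin] with v hv1 hv2 hv3 hfv
    exact hv1 ⟨⟨hv2, hfv⟩, hv3⟩
  -- `f` is open at some point of the ball
  obtain ⟨u, hu, hmap⟩ :=
    exists_map_nhds_eq_of_isolated hdimK isOpen_ball ⟨0, mem_ball_self hρ⟩ hfd hiso'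
  have himg : f '' ball 0 ρ ∈ 𝓝 (f u) := by
    rw [← hmap]; exact image_mem_map (isOpen_ball.mem_nhds hu)
  -- `Δ` vanishes at the base points of the piece (they are off `G`), hence near `f u`
  have hΔ0 : ∀ v ∈ ball (0 : K) ρ, Δ (f v) = 0 := by
    intro v hv
    by_contra hne
    have hvG : f v ∈ G := hgood (f v) (hfmem v hv) hne
    exact hN₀T (Ψ₀ v) (hNN₁ (hΨmem v hv).2).1 ⟨(hΨmem v hv).1, hvG⟩
  have hev : Δ =ᶠ[𝓝 (f u)] 0 := by
    filter_upwards [himg] with z hz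
    obtain ⟨v, hv, rfl⟩ := hz
    exact hΔ0 v hv
  exact hΔne (f u) (hfmem u hu) hev

/-- **Density of the part over `G` for sets of pure dimension `dim E'`.** If every regular point
of `Z` over `U'` has codimension `m + 1`, then over any open `V' ⊆ U'` the set `Z` lies in the
closure of its part over `G ∩ V'` (regular points are dense, `mem_closure_regLocus`, and lie in
that closure by `mem_closure_good_of_isRegPt_of_proper`).
[cite: Chirka1989, §4.4, p. 48; §3.5 Prop. 4] -/
theorem subset_closure_good_of_pure [FiniteDimensional ℂ E'] (hU' : IsOpen U')
    (hcl : ∀ x ∈ closure Z, x.1 ∈ U' → x ∈ Z) (han : ∀ x ∈ Z, x.1 ∈ U' → IsZeroSetAt Z x)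
    (hR : ∀ x ∈ Z, x.1 ∈ U' → ‖x.2‖ ≤ R)
    (hG : ∀ z', z' ∈ G ↔ z' ∈ U' ∧ ∃ δ > 0, ∃ (k : ℕ) (τ : Fin k → E' → (Fin (m + 1) → ℂ)),
      (∀ j, DifferentiableOn ℂ (τ j) (ball z' δ)) ∧
      (∀ y ∈ ball z' δ, ∀ j j', j ≠ j' → τ j y ≠ τ j' y) ∧
      ∀ y ∈ ball z' δ, ∀ w, (y, w) ∈ Z ↔ ∃ j, w = τ j y)
    (hpure : ∀ x ∈ regLocus Z, x.1 ∈ U' → IsRegPt Z (m + 1) x)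
    {V' : Set E'} (hV' : IsOpen V') (hV'U : V' ⊆ U') :
    {x : E' × (Fin (m + 1) → ℂ) | x ∈ Z ∧ x.1 ∈ V'} ⊆
      closure {x : E' × (Fin (m + 1) → ℂ) | x ∈ Z ∧ x.1 ∈ G ∩ V'} := by
  rintro x ⟨hxZ, hxV⟩
  have hO : IsOpen (Prod.fst ⁻¹' V' : Set (E' × (Fin (m + 1) → ℂ))) := hV'.preimage continuous_fst
  have h1 : x ∈ closure (regLocus Z) := mem_closure_regLocus (han x hxZ (hV'U hxV)) hxZ
  have h2 : regLocus Z ∩ Prod.fst ⁻¹' V' ⊆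
      closure {x : E' × (Fin (m + 1) → ℂ) | x ∈ Z ∧ x.1 ∈ G ∩ V'} := by
    rintro y ⟨hyreg, hyV⟩
    have hyZ : y ∈ Z := hyreg.1
    have h3 := mem_closure_good_of_isRegPt_of_proper hU' hcl han hR hG hyZ (hV'U hyV)
      (hpure y hyreg (hV'U hyV))
    have h4 := hO.closure_inter ⟨h3, hyV⟩
    refine closure_mono ?_ h4
    rintro z ⟨⟨hzZ, hzG⟩, hzV⟩
    exact ⟨hzZ, hzG, hzV⟩
  have h5 := hO.closure_inter ⟨h1, hxV⟩
  exact closure_minimal h2 isClosed_closure h5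

end Good

/-! ### Rim: analytic sets near a closed polydisc which miss its rim -/

section Rim

variable {a' : E'} {a'' : Fin (m + 1) → ℂ} {ε r : ℝ}

omit [NormedSpace ℂ E'] in
/-- A point of the closure of `Z` at which `Z` is cut out by holomorphic equations lies in `Z`
(cf. `IsZeroSetAt.mem_of_mem_closure` in `AnalyticSetIsolatingPlanes.lean`, not imported here).
[folklore] -/
private theorem mem_of_isZeroSetAt_of_mem_closure [NormedSpace ℂ E']
    {x : E' × (Fin (m + 1) → ℂ)} (h : IsZeroSetAt Z x) (hx : x ∈ closure Z) : x ∈ Z := by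
  obtain ⟨U, hU, hxU, N, g, hg, hZU⟩ := h
  by_contra hxZ
  have hgx : g x ≠ 0 := fun h0 => hxZ (hZU.symm.subset ⟨hxU, h0⟩).1
  have hO : IsOpen (U ∩ g ⁻¹' {0}ᶜ) :=
    hg.continuousOn.isOpen_inter_preimage hU isOpen_compl_singleton
  obtain ⟨y, ⟨hyU, hgy⟩, hyZ⟩ := _root_.mem_closure_iff.1 hx _ hO ⟨hxU, hgx⟩
  exact hgy (hZU.subset ⟨hyZ, hyU⟩).2

/-- **Closedness over the base ball.** If `Z` is cut out by holomorphic equations near every point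
of the closed polydisc `closedBall a' ε ×ˢ closedBall a'' r` and misses its rim
`closedBall a' ε ×ˢ sphere a'' r`, then `Z ∩ (ball a' ε ×ˢ ball a'' r)` is closed over
`ball a' ε`. [Chirka, *Complex Analytic Sets*, §3.7, §15.5 p. 203] [folklore] -/
private theorem closure_box_of_rim (hbox : ∀ x ∈ closedBall a' ε ×ˢ closedBall a'' r, IsZeroSetAt Z x)
    (hrim : ∀ x ∈ Z, x.1 ∈ closedBall a' ε → x.2 ∈ closedBall a'' r → x.2 ∈ ball a'' r) :
    ∀ x ∈ closure (Z ∩ ball a' ε ×ˢ ball a'' r), x.1 ∈ ball a' ε →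
      x ∈ Z ∩ ball a' ε ×ˢ ball a'' r := by
  intro x hx hx1
  have hxc : x ∈ closedBall a' ε ×ˢ closedBall a'' r := by
    have h1 : closure (Z ∩ ball a' ε ×ˢ ball a'' r) ⊆ closure (ball a' ε ×ˢ ball a'' r) :=
      closure_mono inter_subset_right
    have h2 := h1 hx
    rw [closure_prod_eq] at h2
    exact ⟨closure_ball_subset_closedBall h2.1, closure_ball_subset_closedBall h2.2⟩
  have hxZ : x ∈ Z :=
    mem_of_isZeroSetAt_of_mem_closure (hbox x hxc) (closure_mono inter_subset_left hx)
  exact ⟨hxZ, hx1, hrim x hxZ hxc.1 hxc.2⟩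

omit [NormedSpace ℂ E'] in
/-- The part of `Z` in the open polydisc is cut out by holomorphic equations near each of its
points. [folklore] -/
private theorem isZeroSetAt_box_of_rim [NormedSpace ℂ E']
    (hbox : ∀ x ∈ closedBall a' ε ×ˢ closedBall a'' r, IsZeroSetAt Z x) :
    ∀ x ∈ Z ∩ ball a' ε ×ˢ ball a'' r, IsZeroSetAt (Z ∩ ball a' ε ×ˢ ball a'' r) x := by
  rintro x ⟨-, hxV⟩
  have hxc : x ∈ closedBall a' ε ×ˢ closedBall a'' r :=
    ⟨ball_subset_closedBall hxV.1, ball_subset_closedBall hxV.2⟩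
  exact (hbox x hxc).congr (isOpen_ball.prod isOpen_ball) hxV (by rw [inter_assoc, inter_self])

omit [NormedSpace ℂ E'] in
/-- The fibre coordinates of the points of the open polydisc are bounded by `‖a''‖ + r`.
[folklore] -/
private theorem norm_snd_le_of_box :
    ∀ x ∈ Z ∩ ball a' ε ×ˢ ball a'' r, x.1 ∈ ball a' ε → ‖x.2‖ ≤ ‖a''‖ + r := by
  rintro x ⟨-, -, hx2⟩ -
  rw [mem_ball, dist_eq_norm] at hx2
  have := norm_le_norm_sub_add x.2 a''
  linarith

omit [NormedSpace ℂ E'] in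
/-- Pure codimension `m + 1` of the regular points passes to the part in the open polydisc.
[folklore] -/
private theorem pure_box_of_pure [NormedSpace ℂ E']
    (hpure : ∀ x ∈ regLocus Z, x ∈ ball a' ε ×ˢ ball a'' r → IsRegPt Z (m + 1) x) :
    ∀ x ∈ regLocus (Z ∩ ball a' ε ×ˢ ball a'' r), x.1 ∈ ball a' ε →
      IsRegPt (Z ∩ ball a' ε ×ˢ ball a'' r) (m + 1) x := by
  rintro x ⟨⟨hxZ, hxV⟩, p, hp⟩ -
  have hV : IsOpen (ball a' ε ×ˢ ball a'' r : Set (E' × (Fin (m + 1) → ℂ))) :=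
    isOpen_ball.prod isOpen_ball
  have heq : (Z ∩ ball a' ε ×ˢ ball a'' r) ∩ ball a' ε ×ˢ ball a'' r = Z ∩ ball a' ε ×ˢ ball a'' r := by
    rw [inter_assoc, inter_self]
  have hp' : IsRegPt Z p x := hp.congr hV hxV heq
  exact (hpure x ⟨hxZ, p, hp'⟩ hxV).congr hV hxV heq.symm

/-- **Analytic sets near a closed polydisc missing its rim are analytic covers over smaller base
balls** (the packaged form used for Bishop's theorem, [Chirka1989, §15.5, p. 203]: "`A_j ∩ U` is
an analytic cover over `U'`"). Let `Z` be cut out by holomorphic equations near every point of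
`closedBall a' ε ×ˢ closedBall a'' r` and miss the rim `closedBall a' ε ×ˢ sphere a'' r`, and let
`ε₁ < ε`. Then there are an open `G ⊆ ball a' ε₁` and `K` such that the part of
`Z ∩ (G ×ˢ ball a'' r)` is a cover piece over `ball a' ε₁` with good set `G`, at most `K` sheets
and fibre bound `‖a''‖ + r`; and if all regular points of `Z` in the open polydisc have
codimension `m + 1`, this part is dense in `Z ∩ (ball a' ε₁ ×ˢ ball a'' r)`, which is closed over
`ball a' ε₁`. [cite: Chirka1989, §3.7 Thm., §4.1, §4.4, §15.5 p. 203] -/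
theorem exists_coverPiece_of_rim [FiniteDimensional ℂ E'] {ε₁ : ℝ}
    (hbox : ∀ x ∈ closedBall a' ε ×ˢ closedBall a'' r, IsZeroSetAt Z x)
    (hrim : ∀ x ∈ Z, x.1 ∈ closedBall a' ε → x.2 ∈ closedBall a'' r → x.2 ∈ ball a'' r)
    (hε₁ : ε₁ < ε) :
    ∃ (G : Set E') (K : ℕ), G ⊆ ball a' ε₁ ∧
      CoverPiece {x : E' × (Fin (m + 1) → ℂ) | x ∈ Z ∧ x.1 ∈ G ∧ x.2 ∈ ball a'' r}
        (ball a' ε₁) G K (‖a''‖ + r) ∧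
      (∀ x ∈ closure {x : E' × (Fin (m + 1) → ℂ) | x ∈ Z ∧ x.1 ∈ G ∧ x.2 ∈ ball a'' r},
        x.1 ∈ ball a' ε₁ → x ∈ Z ∧ x.2 ∈ ball a'' r) ∧
      ((∀ x ∈ regLocus Z, x ∈ ball a' ε ×ˢ ball a'' r → IsRegPt Z (m + 1) x) →
        Z ∩ ball a' ε₁ ×ˢ ball a'' r ⊆
          closure {x : E' × (Fin (m + 1) → ℂ) | x ∈ Z ∧ x.1 ∈ G ∧ x.2 ∈ ball a'' r}) := by
  classical
  set Z₀ : Set (E' × (Fin (m + 1) → ℂ)) := Z ∩ ball a' ε ×ˢ ball a'' r with hZ₀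
  have hU' : IsOpen (ball a' ε) := isOpen_ball
  have hcl : ∀ x ∈ closure Z₀, x.1 ∈ ball a' ε → x ∈ Z₀ := closure_box_of_rim hbox hrim
  have han : ∀ x ∈ Z₀, x.1 ∈ ball a' ε → IsZeroSetAt Z₀ x := fun x hx _ =>
    isZeroSetAt_box_of_rim hbox x hx
  have hR : ∀ x ∈ Z₀, x.1 ∈ ball a' ε → ‖x.2‖ ≤ ‖a''‖ + r := norm_snd_le_of_box
  -- the unramified part
  set G₀ : Set E' := {z' | z' ∈ ball a' ε ∧ ∃ δ > 0, ∃ (k : ℕ) (τ : Fin k → E' → (Fin (m + 1) → ℂ)),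
      (∀ j, DifferentiableOn ℂ (τ j) (ball z' δ)) ∧
      (∀ y ∈ ball z' δ, ∀ j j', j ≠ j' → τ j y ≠ τ j' y) ∧
      ∀ y ∈ ball z' δ, ∀ w, (y, w) ∈ Z₀ ↔ ∃ j, w = τ j y} with hG₀
  have hG : ∀ z', z' ∈ G₀ ↔ z' ∈ ball a' ε ∧ ∃ δ > 0, ∃ (k : ℕ)
      (τ : Fin k → E' → (Fin (m + 1) → ℂ)),
      (∀ j, DifferentiableOn ℂ (τ j) (ball z' δ)) ∧
      (∀ y ∈ ball z' δ, ∀ j j', j ≠ j' → τ j y ≠ τ j' y) ∧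
      ∀ y ∈ ball z' δ, ∀ w, (y, w) ∈ Z₀ ↔ ∃ j, w = τ j y := fun z' => Iff.rfl
  -- uniform fibre bound over the smaller closed ball
  have hV'U : ball a' ε₁ ⊆ ball a' ε := ball_subset_ball hε₁.le
  obtain ⟨K, hK⟩ := exists_forall_fibre_card_le_of_proper hU' hcl han hR
    (isCompact_closedBall a' ε₁) (closedBall_subset_ball hε₁)
  have hK' : ∀ z' ∈ ball a' ε₁, ∃ T : Finset (Fin (m + 1) → ℂ), T.card ≤ K ∧
      {w | (z', w) ∈ Z₀} ⊆ ↑T := fun z' hz' => hK z' (ball_subset_closedBall hz')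
  have hpiece := coverPiece_good_of_proper hU' hcl han hR hG isOpen_ball hV'U hK'
  -- the two descriptions of the piece agree
  have hSeq : {x : E' × (Fin (m + 1) → ℂ) | x ∈ Z₀ ∧ x.1 ∈ G₀ ∩ ball a' ε₁} =
      {x : E' × (Fin (m + 1) → ℂ) | x ∈ Z ∧ x.1 ∈ G₀ ∩ ball a' ε₁ ∧ x.2 ∈ ball a'' r} := by
    ext x
    constructor
    · rintro ⟨⟨hxZ, -, hx2⟩, hxG⟩; exact ⟨hxZ, hxG, hx2⟩
    · rintro ⟨hxZ, hxG, hx2⟩; exact ⟨⟨hxZ, hV'U hxG.2, hx2⟩, hxG⟩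
  refine ⟨G₀ ∩ ball a' ε₁, K, inter_subset_right, hSeq ▸ hpiece, ?_, ?_⟩
  · intro x hx hx1
    rw [← hSeq] at hx
    have := hcl x (closure_mono (fun y hy => hy.1) hx) (hV'U hx1)
    exact ⟨this.1, this.2.2⟩
  · intro hpure
    have hpure₀ : ∀ x ∈ regLocus Z₀, x.1 ∈ ball a' ε → IsRegPt Z₀ (m + 1) x :=
      pure_box_of_pure hpure
    have hdense := subset_closure_good_of_pure hU' hcl han hR hG hpure₀ isOpen_ball hV'U
    rw [hSeq] at hdense
    rintro x ⟨hxZ, hx1, hx2⟩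
    exact hdense ⟨⟨hxZ, hV'U hx1, hx2⟩, hx1⟩

end Rim

end ProperProjection

end SCV
end Literature.Geometry.Kaehler

end
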